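import Mathlib
import Literature.Computability.Complexity.ACC0SubsetTC0
import Literature.Computability.Complexity.TC0SubsetNC1Reduction
import HarnessLib

/-!
# Crux `MobiusLadder.LiouvilleOrthogonalTC0` (stmt-QuantumAdvantage-1393), line `Sketch`:
`stub_smallMajSim` — majority gates of small fan-in are depth-two DNFs over `acBasis`

Registered stub `stub_smallMajSim` (lead `prover-line-stmt-QuantumAdvantage-1393-c2-0`).
Statement: a circuit `C` on `n` inputs over `tcBasis = {¬} ∪ {∧ₖ, ∨ₖ, MAJₖ}` all of whose
majority gates `MAJₖ` satisfy `2^k ≤ M` is computed by a circuit over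
`acBasis = {¬} ∪ {∧ₖ, ∨ₖ}` of `acDepth` at most `2 · C.acDepth` (negations free) and size at
most `C.size · (M + 1)`.

Construction (folklore circuit surgery; the gate-by-gate pattern of `GateList.exists_tcSim` and
`Circuit.acRealOver_tcBasis_of_accBasis` of `ACC0SubsetTC0.lean`, Vollmer 1999, §1.4,
Lemma 1.36 (3)):
* `SmallMajSim.maj_iff_exists_subset`, `SmallMajSim.acRealOver_maj` —
  `MAJₖ(y) = [k ≤ 2 · #ones(y)] = ⋁_{S ⊆ Fin k, |S| = ⌈k/2⌉} ⋀_{a ∈ S} y_a`, a depth-two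
  realization over `acBasis` with at most `2^k + 1` gates (one `∧` per subset `S`, at most
  `#Finset (Fin k) = 2^k` of them, and one `∨`);
* `SmallMajSim.acRealOver_tcGate` — hence every gate `f ∈ tcBasis` with `2^k ≤ M` whenever
  `f = MAJₖ` is realized over `acBasis` at depth `2 · acWeight f` (`¬` free) with `≤ M + 1`
  gates;
* `SmallMajSim.exists_acSim` — gate-by-gate simulation with depth bookkeeping: each gate is
  replaced by its gadget relocated behind the simulation built so far and re-wired to the wires
  carrying its arguments (`GateList.vals_append_reloc`, `GateList.wdepths_append_reloc_le`);
* `SmallMajSim.acRealOver_of_smallMaj` and `stub_smallMajSim` — the circuit-level statement,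
  extracted by `ACRealOver.toCircuit`.
-/

set_option linter.dupNamespace false -- D-0017: single-problem summit ⇒ `QuantumAdvantage.QuantumAdvantage` by design

namespace Summit.QuantumAdvantage.QuantumAdvantage.Theorems.LiouvilleOrthogonalTC0

open Finset
open Literature.Computability.Complexity
open Literature.Computability.Complexity.GateList

namespace SmallMajSim

/-! ### The majority gadget -/

/-- **Majority as "some half-size subset is all ones"**: `k ≤ 2 · #ones(y)` iff some
`S ⊆ Fin k` with `|S| = ⌈k/2⌉ = (k + 1) / 2` has `y a = true` for all `a ∈ S`. -/
theorem maj_iff_exists_subset {k : ℕ} (y : Fin k → Bool) :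
    k ≤ 2 * GateFn.numOnes y ↔
      ∃ S : {S : Finset (Fin k) // S.card = (k + 1) / 2}, ∀ a : ↥(S.1), y a = true := by
  unfold GateFn.numOnes
  constructor
  · intro h
    have ht : (k + 1) / 2 ≤ (univ.filter fun i => y i = true).card := by omega
    obtain ⟨S, hS, hcard⟩ := Finset.le_card_iff_exists_subset_card.1 ht
    exact ⟨⟨S, hcard⟩, fun a => (Finset.mem_filter.1 (hS a.2)).2⟩
  · rintro ⟨⟨S, hcard⟩, hS⟩
    have hsub : S ⊆ univ.filter fun i => y i = true := fun a ha =>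
      Finset.mem_filter.2 ⟨mem_univ _, hS ⟨a, ha⟩⟩
    have hle := Finset.card_le_card hsub
    omega

/-- **The majority gadget**: `MAJₖ`, as a function of its `k` argument bits, is realized over
`acBasis` at depth `2` with at most `2^k + 1` gates — the `∨` over the subsets `S ⊆ Fin k` with
`|S| = ⌈k/2⌉` of the `∧` of the arguments in `S`. -/
theorem acRealOver_maj (k : ℕ) :
    ACRealOver acBasis (fun y : Fin k → Bool => (GateFn.maj k).2 y) 2 (2 ^ k + 1) := by
  have hand : ∀ S : {S : Finset (Fin k) // S.card = (k + 1) / 2},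
      ACReal (fun y : Fin k → Bool => decide (∀ a : ↥(S.1), y a = true)) 1 1 := fun S =>
    (acReal_forall_fintype fun a : ↥(S.1) => acReal_input (ι := Fin k) (a : Fin k)).mono
      (by omega) (by omega)
  have hor := acReal_exists_fintype hand
  refine ((hor.toOver subset_rfl).congr fun y => ?_).mono le_rfl ?_
  · show decide _ = decide (k ≤ 2 * GateFn.numOnes y)
    rw [decide_eq_decide, maj_iff_exists_subset y]
    simp only [decide_eq_true_eq]
  · have h1 : Fintype.card {S : Finset (Fin k) // S.card = (k + 1) / 2} ≤ 2 ^ k :=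
      (Fintype.card_subtype_le _).trans_eq (by rw [Fintype.card_finset, Fintype.card_fin])
    omega

/-- **Every gate of `tcBasis` with small majority fan-in is a depth-`2 · acWeight` gadget over
`acBasis`**: `¬` (depth `0`, itself), `∧ₖ`/`∨ₖ` (depth `1`, itself), `MAJₖ` with `2^k ≤ M`
(depth `2`, `acRealOver_maj`); at most `M + 1` gates in each case. -/
theorem acRealOver_tcGate {M : ℕ} {f : GateFn} (hf : f ∈ tcBasis)
    (hM : ∀ k : ℕ, f = GateFn.maj k → 2 ^ k ≤ M) :
    ACRealOver acBasis (fun y : Fin f.1 → Bool => f.2 y) (2 * acWeight f) (M + 1) := by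
  rcases hf with hf | hf
  · -- a gate of `acBasis`: kept
    by_cases hnot : f = GateFn.not
    · subst hnot
      exact ((acRealOver_notInput mem_acBasis_not (0 : Fin 1)).congr fun y => rfl).mono
        (by simp) (by omega)
    · have h := acRealOver_gate (B := acBasis) f hf
        (f := fun j (y : Fin f.1 → Bool) => y j) (s := fun _ => 0)
        (fun j => acRealOver_input acBasis j)
      refine (h.congr fun y => rfl).mono ?_ ?_
      · have hw : acWeight f = 1 := by simp [acWeight, hnot]
        omega
      · simp only [sum_const_zero, zero_add]
        omega
  · -- a majority gate: the gadget
    obtain ⟨k, hk⟩ := Set.mem_iUnion.1 hf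
    rw [Set.mem_singleton_iff] at hk
    subst hk
    have h2k : 2 ^ k ≤ M := hM k rfl
    exact (acRealOver_maj k).mono (by simp) (by omega)

/-! ### Gate-by-gate simulation with depth bookkeeping -/

/-- **Simulation of a `tcBasis` program with small majority gates by an `acBasis` program, gate
by gate, with depths** (the pattern of `GateList.exists_tcSim`): for a well-formed program `gs`
over `tcBasis` on the inputs `Fin n` whose majority gates `MAJₖ` have `2^k ≤ M` there are a
well-formed program `ns` over `acBasis` with `|ns| ≤ |gs| · (M + 1)` and wires `φ j`
(`j < |gs|`) of `ns` such that `φ j` carries the value of gate `j` of `gs` on every input, at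
`acWeight`-depth at most twice the `acWeight`-depth of gate `j` in `gs`: gate `j` is replaced by
its gadget (`acRealOver_tcGate`) relocated behind the simulation of the gates `< j` and re-wired
to the wires carrying its arguments. -/
theorem exists_acSim {n M : ℕ} (gs : List (Gate (Fin n))) (hwf : WF gs)
    (hB : ∀ g ∈ gs, g.fn ∈ tcBasis) (hM : ∀ g ∈ gs, ∀ k : ℕ, g.fn = GateFn.maj k → 2 ^ k ≤ M) :
    ∃ (ns : List (Gate (Fin n))) (φ : ℕ → Fin n ⊕ ℕ), WF ns ∧ (∀ g ∈ ns, g.fn ∈ acBasis) ∧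
      ns.length ≤ gs.length * (M + 1) ∧
      ∀ j < gs.length, OutOK ns.length (φ j) ∧
        (∀ x, wireOf x (vals ns x) (φ j) = (vals gs x).getD j false) ∧
        wireDepthOf (wdepths acWeight ns) (φ j) ≤ 2 * (wdepths acWeight gs).getD j 0 := by
  induction gs using List.reverseRecOn with
  | nil =>
    exact ⟨[], fun _ => Sum.inr 0, WF.nil, by simp, by simp, fun j hj => absurd hj (by simp)⟩
  | append_singleton gs g ih =>
    obtain ⟨ns, φ, hwfn, hBn, hlen, hφ⟩ := ih hwf.of_append_left
      (fun g' hg' => hB g' (List.mem_append_left _ hg'))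
      (fun g' hg' => hM g' (List.mem_append_left _ hg'))
    have hgB : g.fn ∈ tcBasis := hB g (by simp)
    have hgM : ∀ k : ℕ, g.fn = GateFn.maj k → 2 ^ k ≤ M := hM g (by simp)
    have hok : GateOK gs.length g := hwf.getLast
    -- the wires of `ns` carrying the arguments of `g`
    let ρ : Fin g.arity → Fin n ⊕ ℕ := fun a => Sum.elim Sum.inl φ (g.args a)
    have hρOK : WiresOK ns.length ρ := by
      intro a m' hm'
      cases hga : g.args a with
      | inl i => simp [ρ, hga] at hm'
      | inr j =>
        simp only [ρ, hga, Sum.elim_inr] at hm'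
        exact (hφ j (hok a j hga)).1 m' hm'
    have hρval : ∀ (x : Fin n → Bool) (a : Fin g.arity),
        wireOf x (vals ns x) (ρ a) = wireOf x (vals gs x) (g.args a) := by
      intro x a
      cases hga : g.args a with
      | inl i => simp [ρ, hga]
      | inr j =>
        simp only [ρ, hga, Sum.elim_inr, wireOf_inr]
        exact (hφ j (hok a j hga)).2.1 x
    set Dg := univ.sup fun a => wireDepthOf (wdepths acWeight gs) (g.args a) with hDg
    have hρdep : ∀ a, wireDepthOf (wdepths acWeight ns) (ρ a) ≤ 2 * Dg := by
      intro a
      have hle : wireDepthOf (wdepths acWeight gs) (g.args a) ≤ Dg :=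
        Finset.le_sup (f := fun a => wireDepthOf (wdepths acWeight gs) (g.args a)) (mem_univ a)
      cases hga : g.args a with
      | inl i => simp [ρ, hga]
      | inr j =>
        simp only [ρ, hga, Sum.elim_inr]
        rw [hga, wireDepthOf_inr] at hle
        exact (hφ j (hok a j hga)).2.2.trans (Nat.mul_le_mul_left 2 hle)
    -- the gadget of `g`, relocated behind `ns` along `ρ`
    have hacc : ACRealOver acBasis (fun y : Fin g.arity → Bool => g.op y) (2 * acWeight g.fn)
        (M + 1) := acRealOver_tcGate hgB hgM
    obtain ⟨gs', o, hwf', hB', ho', hl', hdep', hev'⟩ := hacc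
    obtain ⟨ds', hds', hlen', hle'⟩ :=
      wdepths_append_reloc_le acWeight ns gs' ρ hρOK (2 * Dg) hρdep
    refine ⟨ns ++ gs'.map (reloc ρ ns.length),
      fun j => if j = gs.length then shiftWire ρ ns.length o else φ j,
      hwfn.append_reloc hwf' hρOK, ?_, ?_, ?_⟩
    · -- basis
      intro g' hg'
      rw [List.mem_append, List.mem_map] at hg'
      rcases hg' with hg' | ⟨g₀, hg₀, rfl⟩
      · exact hBn g' hg'
      · rw [reloc_fn]; exact hB' g₀ hg₀
    · -- length
      rw [List.length_append, List.length_map, List.length_append, List.length_singleton,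
        add_one_mul]
      exact Nat.add_le_add hlen hl'
    · -- the wires
      intro j hj
      dsimp only
      rw [List.length_append, List.length_singleton] at hj
      rcases (Nat.lt_succ_iff_lt_or_eq.1 hj) with hj | rfl
      · -- an old gate
        obtain ⟨hoj, hvj, hdj⟩ := hφ j hj
        rw [if_neg (Nat.ne_of_lt hj)]
        refine ⟨fun m' hm' => (hoj m' hm').trans_le (by simp), fun x => ?_, ?_⟩
        · rw [wireOf_vals_append _ _ _ _ hoj, hvj x, vals_append_singleton,
            List.getD_eq_getElem?_getD, List.getD_eq_getElem?_getD,
            List.getElem?_append_left (by simpa using hj)]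
        · rw [wireDepthOf_wdepths_append _ _ _ _ hoj, wdepths_append_singleton,
            List.getD_eq_getElem?_getD, List.getElem?_append_left (by simpa using hj)]
          rw [List.getD_eq_getElem?_getD] at hdj
          exact hdj
      · -- the new gate
        rw [if_pos rfl]
        refine ⟨?_, fun x => ?_, ?_⟩
        · intro m' hm'
          cases hoo : o with
          | inl a =>
            rw [hoo] at hm'
            simp only [shiftWire] at hm'
            have := hρOK a m' hm'
            rw [List.length_append]; omega
          | inr m'' =>
            rw [hoo] at hm'
            simp only [shiftWire, Sum.inr.injEq] at hm'
            have := ho' m'' hoo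
            rw [List.length_append, List.length_map]; omega
        · rw [vals_append_reloc ns gs' ρ hρOK x,
            wireOf_shiftWire x (vals ns x) _ (length_vals ns x) ρ hρOK o, hev',
            vals_append_singleton, List.getD_eq_getElem?_getD,
            List.getElem?_append_right (by simp), length_vals, Nat.sub_self]
          simp only [List.getElem?_cons_zero, Option.getD_some]
          change g.op (fun a => wireOf x (vals ns x) (ρ a)) =
            g.op fun a => wireOf x (vals gs x) (g.args a)
          simp only [hρval x]
        · rw [getD_wdepths_append_singleton, hds', mul_add]
          cases hoo : o with
          | inl a =>
            simp only [shiftWire]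
            rw [wireDepthOf_append_of_lt _ _ (ρ a) (fun m' hm' => by
              rw [length_wdepths]; exact hρOK a m' hm')]
            exact (hρdep a).trans (Nat.le_add_left _ _)
          | inr m'' =>
            simp only [shiftWire, wireDepthOf_inr, List.getD_eq_getElem?_getD]
            rw [List.getElem?_append_right (by rw [length_wdepths]; omega), length_wdepths,
              Nat.add_sub_cancel]
            have h1 := hle' m''
            rw [List.getD_eq_getElem?_getD, List.getD_eq_getElem?_getD] at h1
            refine h1.trans (Nat.add_le_add_right ?_ _)
            have h2 := hdep'
            rw [hoo, wireDepthOf_inr, List.getD_eq_getElem?_getD] at h2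
            exact h2

/-! ### Circuits -/

/-- **A `tcBasis` circuit with small majority gates is realized over `acBasis`** at depth
`2 · acDepth` with `size · (M + 1)` gates (the pattern of `Circuit.acRealOver_tcBasis_of_accBasis`;
no fan-in normalisation is needed here): simulate gate by gate (`exists_acSim`) and read off the
output wire. -/
theorem acRealOver_of_smallMaj {n M : ℕ} (C : Circuit (Fin n)) (hB : C.IsOver tcBasis)
    (hM : ∀ g ∈ C.gates, ∀ k : ℕ, g.fn = GateFn.maj k → 2 ^ k ≤ M) :
    ACRealOver acBasis C.eval (2 * C.acDepth) (C.size * (M + 1)) := by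
  obtain ⟨ns, φ, hwf, hBn, hlen, hφ⟩ := exists_acSim C.gates (wf_gates C) hB hM
  have hdep₀ : C.acDepth = wireDepthOf (wdepths acWeight C.gates) C.output :=
    circuit_depthWith C acWeight
  cases ho : C.output with
  | inl i =>
    refine ⟨ns, Sum.inl i, hwf, hBn, (fun m' h => by cases h), hlen, (by simp), fun x => ?_⟩
    rw [circuit_eval, ho, wireOf_inl, wireOf_inl]
  | inr j =>
    have hj : j < C.gates.length := C.wf_output j ho
    obtain ⟨hok, hval, hdep⟩ := hφ j hj
    refine ⟨ns, φ j, hwf, hBn, hok, hlen, ?_, fun x => ?_⟩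
    · refine hdep.trans (Nat.mul_le_mul_left 2 (le_of_eq ?_))
      rw [hdep₀, ho, wireDepthOf_inr]
    · rw [hval x, circuit_eval, ho, wireOf_inr]

end SmallMajSim

/-- **Registered stub `stub_smallMajSim`: majority gates of small fan-in do not help.** A circuit
`C` on `n` inputs over `tcBasis` all of whose majority gates `MAJₖ` satisfy `2^k ≤ M` is computed
by a circuit `C'` over `acBasis` with `acDepth C' ≤ 2 · acDepth C`, `|C'| ≤ |C| · (M + 1)` and
`C'.eval = C.eval`: every `MAJₖ` gate becomes the depth-two DNF over the at most `2^k ≤ M`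
majority subsets, every other gate is kept (`SmallMajSim.acRealOver_of_smallMaj`,
`ACRealOver.toCircuit`). -/
theorem stub_smallMajSim {n : ℕ} (M : ℕ) (C : Circuit (Fin n)) (hB : C.IsOver tcBasis)
    (hM : ∀ g ∈ C.gates, ∀ k : ℕ, g.fn = GateFn.maj k → 2 ^ k ≤ M) :
    ∃ C' : Circuit (Fin n), C'.IsOver acBasis ∧ C'.acDepth ≤ 2 * C.acDepth ∧
      C'.size ≤ C.size * (M + 1) ∧ ∀ x, C'.eval x = C.eval x :=
  (SmallMajSim.acRealOver_of_smallMaj C hB hM).toCircuit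

end Summit.QuantumAdvantage.QuantumAdvantage.Theorems.LiouvilleOrthogonalTC0
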